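import Mathlib
import Summits.HodgeConjecture.CorCM.RMuNormFixedUnits
import Summits.HodgeConjecture.CorCM.RMuNormOddUnit
import HarnessLib

/-!
# Fixed units are norms when an involution acts freely on the maximal spectrum

General-algebra layer of lane RMU-NORM (cell pub-hodgecm2), file 5: the criterion behind files
2–3 in its natural generality.

Let `R` be a reduced commutative Artinian ring (e.g. a finite étale algebra over a field: a
finite product of fields) and `ρ` a ring involution of `R`. If `ρ` moves EVERY maximal ideal
(`𝔪.comap ρ ≠ 𝔪` for all maximal `𝔪` — `ρ` acts on `MaxSpec R ≅ {factors}` without fixed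
points), then `R` contains `u` with `u² = 1`, `ρ u = -u` (`exists_sq_eq_one_map_eq_neg_of_free`):
by the Chinese remainder theorem (`IsArtinianRing.equivPi`) take `u ≡ ε(𝔪) (mod 𝔪)` for an odd
sign function `ε` of the free involution `𝔪 ↦ 𝔪.comap ρ` (`exists_sign_of_involutive`, file 2).
Consequently, when `2` is a unit, every `ρ`-fixed unit of `R` is a norm `a · ρ a`
(`exists_isUnit_mul_map_eq_of_free`, via file 1).

For `R = K ⊗_F E` (`K`, `E` fields over `F`, `K/F` finite separable, `ρ = conj ⊗ 1`) the
maximal ideals are the factors of the étale algebra and the hypothesis says that no factor is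
stable under `conj ⊗ 1`; files 2–3 verify it when `E` contains all conjugates of a `conj`-stable
subfield `k₁ ⊆ K` on which `conj` is non-trivial. Reading for [Liu 2021, Def. 4.5 (2)] bullet 4
as in files 3–4 (no `Def45`-level statement here; the Liu-level file is
`Literature/NumberTheory/Automorphic/Liu2021/Def45RMuGalois.lean`, seat hcmisog-isog-2).
HC_CM is NOT proved; nothing here touches the COR-CM chain. [folklore]
-/

namespace Summit.HodgeConjecture.CorCM.RMuNorm

section Free

variable {R : Type*} [CommRing R] [IsArtinianRing R] [IsReduced R]

/-- **An odd square root of unity from a free involution of the maximal spectrum.** Let `R` be a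
reduced commutative Artinian ring and `ρ` a ring involution of `R` such that `𝔪.comap ρ ≠ 𝔪`
for every maximal ideal `𝔪`. Then there is `u ∈ R` with `u * u = 1` and `ρ u = -u`.
[folklore] -/
theorem exists_sq_eq_one_map_eq_neg_of_free (ρ : R ≃+* R) (hρρ : ∀ x, ρ (ρ x) = x)
    (hfree : ∀ 𝔪 : Ideal R, 𝔪.IsMaximal → 𝔪.comap (ρ : R →+* R) ≠ 𝔪) :
    ∃ u : R, u * u = 1 ∧ ρ u = -u := by
  classical
  haveI : Fintype (MaximalSpectrum R) := Fintype.ofFinite _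
  -- the free involution of the maximal spectrum
  let π : MaximalSpectrum R → MaximalSpectrum R := fun m =>
    ⟨m.asIdeal.comap (ρ : R →+* R), Ideal.comap_isMaximal_of_surjective _ ρ.surjective⟩
  have hπas : ∀ m, (π m).asIdeal = m.asIdeal.comap (ρ : R →+* R) := fun _ => rfl
  have hρρ' : (ρ : R →+* R).comp (ρ : R →+* R) = RingHom.id R := RingHom.ext fun x => hρρ x
  have hππ : ∀ m, π (π m) = m := by
    intro m
    apply MaximalSpectrum.ext
    rw [hπas, hπas, Ideal.comap_comap, hρρ', Ideal.comap_id]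
  have hπ : ∀ m, π m ≠ m := fun m h =>
    hfree m.asIdeal m.isMaximal (by rw [← hπas, h])
  obtain ⟨ε, hε, -, hεπ⟩ := exists_sign_of_involutive R π hππ hπ
  -- `u ≡ ε m (mod m)` for every maximal `m`
  let e := IsArtinianRing.equivPi R
  let v : ∀ m : MaximalSpectrum R, R ⧸ m.asIdeal := fun m => Ideal.Quotient.mk m.asIdeal (ε m)
  obtain ⟨u, hu⟩ : ∃ u : R, e u = v := ⟨e.symm v, e.apply_symm_apply v⟩
  have hum : ∀ m : MaximalSpectrum R, u - ε m ∈ m.asIdeal := by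
    intro m
    rw [← Ideal.Quotient.eq]
    have h := congrFun hu m
    rwa [IsArtinianRing.equivPi_apply] at h
  -- injectivity of `R → ∏ R/m`, in the form we need
  have hinj : ∀ x : R, (∀ m : MaximalSpectrum R, x ∈ m.asIdeal) → x = 0 := by
    intro x hx
    apply e.injective
    rw [map_zero]
    funext m
    rw [IsArtinianRing.equivPi_apply, Pi.zero_apply, Ideal.Quotient.eq_zero_iff_mem]
    exact hx m
  have hρε : ∀ m, ρ (ε m) = ε m := fun m => by
    rcases hε m with h | h <;> rw [h]
    · exact map_one ρ
    · rw [map_neg, map_one]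
  refine ⟨u, ?_, ?_⟩
  · rw [← sub_eq_zero]
    apply hinj
    intro m
    have h1 : u * u - 1 = (u - ε m) * (u + ε m) + (ε m * ε m - 1) := by ring
    rw [h1]
    refine m.asIdeal.add_mem (m.asIdeal.mul_mem_right _ (hum m)) ?_
    rcases hε m with h | h <;> simp [h]
  · rw [← sub_eq_zero, sub_neg_eq_add]
    apply hinj
    intro m
    -- `u - ε (π m) ∈ π m = m.comap ρ`, so `ρ u - ε (π m) ∈ m`, and `ε (π m) = - ε m`
    have h1 : ρ u - ε (π m) ∈ m.asIdeal := by
      have h := hum (π m)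
      rw [hπas, Ideal.mem_comap] at h
      simpa only [RingEquiv.coe_toRingHom, map_sub, hρε] using h
    have h2 : ρ u + u = (ρ u - ε (π m)) + (u - ε m) + (ε (π m) + ε m) := by ring
    rw [h2]
    refine m.asIdeal.add_mem (m.asIdeal.add_mem h1 (hum m)) ?_
    rw [hεπ, neg_add_cancel]
    exact m.asIdeal.zero_mem

/-- **Fixed units are norms under a free involution of the maximal spectrum.** Let `R` be a
reduced commutative Artinian ring in which `2` is a unit and `ρ` a ring involution moving every
maximal ideal. Then every `ρ`-fixed unit `t` is `a · ρ a` for a unit `a`. [folklore] -/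
theorem exists_isUnit_mul_map_eq_of_free (h2 : IsUnit (2 : R)) (ρ : R ≃+* R)
    (hρρ : ∀ x, ρ (ρ x) = x) (hfree : ∀ 𝔪 : Ideal R, 𝔪.IsMaximal → 𝔪.comap (ρ : R →+* R) ≠ 𝔪)
    {t : R} (ht : IsUnit t) (hfix : ρ t = t) : ∃ a : R, IsUnit a ∧ a * ρ a = t := by
  obtain ⟨u, hu, hρu⟩ := exists_sq_eq_one_map_eq_neg_of_free ρ hρρ hfree
  haveI : Invertible (2 : R) := h2.invertible
  exact exists_isUnit_mul_map_eq_of_sq_eq_one (ρ : R →+* R) hu hρu ht hfix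

/-- **Anti-invariant units differ by norms under a free involution of the maximal spectrum.**
Same hypotheses; units `β₀, β₁` with `ρ βᵢ = -βᵢ` satisfy `β₀ = β₁ · (a · ρ a)` for a unit `a`.
[folklore] -/
theorem exists_isUnit_eq_mul_norm_of_free (h2 : IsUnit (2 : R)) (ρ : R ≃+* R)
    (hρρ : ∀ x, ρ (ρ x) = x) (hfree : ∀ 𝔪 : Ideal R, 𝔪.IsMaximal → 𝔪.comap (ρ : R →+* R) ≠ 𝔪)
    {β₀ β₁ : R} (hβ₀ : IsUnit β₀) (hρβ₀ : ρ β₀ = -β₀) (hβ₁ : IsUnit β₁) (hρβ₁ : ρ β₁ = -β₁) :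
    ∃ a : R, IsUnit a ∧ β₀ = β₁ * (a * ρ a) := by
  obtain ⟨u, hu, hρu⟩ := exists_sq_eq_one_map_eq_neg_of_free ρ hρρ hfree
  haveI : Invertible (2 : R) := h2.invertible
  exact exists_isUnit_eq_mul_norm_of_sq_eq_one (ρ : R →+* R) hu hρu hβ₀ hρβ₀ hβ₁ hρβ₁

end Free

end Summit.HodgeConjecture.CorCM.RMuNorm
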